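import Summits.ValiantsHypothesis.ValiantsHypothesis.Theorems.SymPencilPerFourW2Levers
import Summits.ValiantsHypothesis.ValiantsHypothesis.Theorems.SymPencilPerFourW2TwoRow

/-!
# Route `SymPencil` — `W₂ = row 0 ⊕ span(E₁₀, E₁₁)` is NOT the kernel space of a size-`27`
# symmetric representation of `per_4` (cell `(10,6,6)`; `--supports` stmt-ValiantsHypothesis-5674
# `SdcSuperquadratic`; rung currency only — nothing here bears on `VP ≠ VNP`)

**Theorem** (`false_of_ker_eq_W2`): in the base-point package with `|ι'| ≤ 26`, `dim (im bL) ≥ 10`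
and kernel space exactly `W₂`: `False`, over any field of characteristic `0`.  Assembly of the
levers (`SymPencilPerFourW2Levers.w2_lever_a/b`: `K_a = bU X^±`, `K_b = bU Y^±`, both of
dimension `≥ 7`) and the two-row base point (`SymPencilPerFourW2TwoRow.w2_pair_vanish`): the
translate `(D + C(a+b))D⁻¹ (K_a ∩ K_b)` lies in `im bL` and hence in the `4`-space
`bU {r = 0}`, so `dim (K_a ∩ K_b) ≤ 4`; but in each of the four sign cases `X^ε + Y^δ` lies in a
hyperplane of the complement, so `dim (K_a ∩ K_b) ≥ 7 + 7 - 9 = 5`.  With `V×`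
(`SymPencilPerFourCrossSix`) and `W_col` (`SymPencilPerFourColSix`) this excludes every coordinate
survivor of the census of `Cruxes/SdcSuperquadratic/PENCIL-CROSS-27.md` (rev 6).  No definitions,
no named facts. [folklore]
-/

noncomputable section

-- single-conjunct layout: Sub = Summit, duplicated namespace component intended
set_option linter.dupNamespace false

namespace Summit.ValiantsHypothesis.ValiantsHypothesis.Theorems.SymPencilPerFourW2

open Matrix MvPolynomial Module
open Literature.Computability.AlgebraicComplexity
open Summit.ValiantsHypothesis.ValiantsHypothesis.Theorems.SymPencilPerFourW2Levers
open Summit.ValiantsHypothesis.ValiantsHypothesis.Theorems.SymPencilPerFourW2TwoRow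

universe u

variable {k : Type u} [Field k]

variable (k) in
/-- The two-row base point `v = a + b` is supported on `W₂`. [folklore] -/
theorem w2_v_support :
    ∀ z : Fin 4 × Fin 4, ¬ (z.1 = 0 ∨ z = (1, 0) ∨ z = (1, 1)) → (fun w : Fin 4 × Fin 4 =>
      (Matrix.of ![![(0 : k), 1, 1, 1], ![1, 0, 0, 0], ![0, 0, 0, 0], ![0, 0, 0, 0]]) w.1 w.2) z = 0 := by
  intro z hz
  obtain ⟨i, j⟩ := z
  by_cases h : (i = 0 ∨ (i, j) = ((1 : Fin 4), (0 : Fin 4)) ∨ (i, j) = ((1 : Fin 4), (1 : Fin 4)))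
  · exact absurd h hz
  · fin_cases i <;> fin_cases j <;> simp at h ⊢

variable (k) in
/-- `v = a + b`. [folklore] -/
theorem w2_v_eq : (fun w : Fin 4 × Fin 4 =>
      (Matrix.of ![![(0 : k), 1, 1, 1], ![1, 0, 0, 0], ![0, 0, 0, 0], ![0, 0, 0, 0]]) w.1 w.2) = (fun z : Fin 4 × Fin 4 =>
      (Matrix.of ![![0, 1, 1, 1], ![0, 0, 0, 0], ![0, 0, 0, 0], ![0, 0, 0, 0]]) z.1 z.2) + (fun z : Fin 4 × Fin 4 =>
      (Matrix.of ![![0, 0, 0, 0], ![1, 0, 0, 0], ![0, 0, 0, 0], ![0, 0, 0, 0]]) z.1 z.2) := by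
  funext z; obtain ⟨i, j⟩ := z
  fin_cases i <;> fin_cases j <;> simp

/-- A vector whose rows `2,3` vanish off column `0` is, modulo `W₂`, the complement embedding of
`(0; x₁₂, x₁₃, x₂₀, x₃₀)`. [folklore] -/
theorem w2_residual (x : Fin 4 × Fin 4 → k) (h21 : x (2, 1) = 0) (h22 : x (2, 2) = 0)
    (h23 : x (2, 3) = 0) (h31 : x (3, 1) = 0) (h32 : x (3, 2) = 0) (h33 : x (3, 3) = 0) :
    ∀ z : Fin 4 × Fin 4, ¬ (z.1 = 0 ∨ z = (1, 0) ∨ z = (1, 1)) →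
      (x - (fun (u : (Fin 2 × Fin 3 → k) × (Fin 4 → k)) => (fun z : Fin 4 × Fin 4 => (Matrix.of ![![0, 0, 0, 0], ![0, 0, u.2 0, u.2 1],
        ![u.2 2, u.1 (0, 0), u.1 (0, 1), u.1 (0, 2)], ![u.2 3, u.1 (1, 0), u.1 (1, 1), u.1 (1, 2)]])
        z.1 z.2))
        ((0 : Fin 2 × Fin 3 → k), (![x (1, 2), x (1, 3), x (2, 0), x (3, 0)] : Fin 4 → k))) z = 0 := by
  intro z hz
  obtain ⟨i, j⟩ := z
  rw [Pi.sub_apply]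
  by_cases h : (i = 0 ∨ (i, j) = ((1 : Fin 4), (0 : Fin 4)) ∨ (i, j) = ((1 : Fin 4), (1 : Fin 4)))
  · exact absurd h hz
  · fin_cases i <;> fin_cases j <;> simp [h21, h22, h23, h31, h32, h33] at h ⊢

variable [CharZero k] {ι' : Type*} [Fintype ι'] [DecidableEq ι']

/-- **`W₂` is not a kernel space at size `27`.**  See the module docstring. [folklore] -/
theorem false_of_ker_eq_W2 {D : Matrix ι' ι' k} (hD : IsUnit D.det) (hDs : Dᵀ = D)
    (bL : (Fin 4 × Fin 4 → k) →ₗ[k] (ι' → k)) (CL : (Fin 4 × Fin 4 → k) →ₗ[k] Matrix ι' ι' k)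
    (hCs : ∀ z, (CL z)ᵀ = CL z) {κ : k} (hκ : κ ≠ 0)
    (hi : ∀ z, bL z ⬝ᵥ D⁻¹ *ᵥ bL z = 0)
    (hii : ∀ z, bL z ⬝ᵥ (D⁻¹ * CL z * D⁻¹) *ᵥ bL z = 0)
    (hN : ∀ v, bL v = 0 → IsUnit (D + CL v).det ∧ ∀ (z : Fin 4 × Fin 4 → k) (s : k),
      κ * MvPolynomial.eval (v + s • z) (perPoly (Fin 4) k) =
        (Matrix.fromBlocks ((s * 0) • (1 : Matrix Unit Unit k))
          (Matrix.replicateRow Unit (s • bL z)) (Matrix.replicateCol Unit (s • bL z))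
          (D + CL v + s • CL z)).det)
    (hker : ∀ x : Fin 4 × Fin 4 → k,
      bL x = 0 ↔ ∀ z : Fin 4 × Fin 4, ¬ (z.1 = 0 ∨ z = (1, 0) ∨ z = (1, 1)) → x z = 0)
    (h10 : 10 ≤ finrank k (LinearMap.range bL)) (hcard : Fintype.card ι' ≤ 26) : False := by
  classical
  -- the complement embedding
  let embU : ((Fin 2 × Fin 3 → k) × (Fin 4 → k)) →ₗ[k] (Fin 4 × Fin 4 → k) :=
    { toFun := fun u => (fun z : Fin 4 × Fin 4 => (Matrix.of ![![0, 0, 0, 0], ![0, 0, u.2 0, u.2 1],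
        ![u.2 2, u.1 (0, 0), u.1 (0, 1), u.1 (0, 2)], ![u.2 3, u.1 (1, 0), u.1 (1, 1), u.1 (1, 2)]])
        z.1 z.2)
      map_add' := fun x y => by
        funext z; obtain ⟨i, j⟩ := z
        fin_cases i <;> fin_cases j <;> simp
      map_smul' := fun c x => by
        funext z; obtain ⟨i, j⟩ := z
        fin_cases i <;> fin_cases j <;> simp }
  set bU := bL ∘ₗ embU with hbU
  have hbU' : ∀ u, bU u = bL (fun z : Fin 4 × Fin 4 => (Matrix.of ![![0, 0, 0, 0], ![0, 0, u.2 0, u.2 1],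
        ![u.2 2, u.1 (0, 0), u.1 (0, 1), u.1 (0, 2)], ![u.2 3, u.1 (1, 0), u.1 (1, 1), u.1 (1, 2)]])
        z.1 z.2) := fun _ => rfl
  clear_value embU bU
  -- the levers
  obtain ⟨h7a, hXa⟩ := w2_lever_a hD hDs bL CL hCs hκ hii hN hker h10 hcard
  obtain ⟨h7b, hYb⟩ := w2_lever_b hD hDs bL CL hCs hκ hii hN hker h10 hcard
  set B := LinearMap.range bL with hBdef
  set Na := (CL (fun z : Fin 4 × Fin 4 =>
      (Matrix.of ![![0, 1, 1, 1], ![0, 0, 0, 0], ![0, 0, 0, 0], ![0, 0, 0, 0]]) z.1 z.2) * D⁻¹).mulVecLin with hNa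
  set Nb := (CL (fun z : Fin 4 × Fin 4 =>
      (Matrix.of ![![0, 0, 0, 0], ![1, 0, 0, 0], ![0, 0, 0, 0], ![0, 0, 0, 0]]) z.1 z.2) * D⁻¹).mulVecLin with hNb
  set Ka := (B ⊓ B.comap Na : Submodule k (ι' → k)) with hKa
  set Kb := (B ⊓ B.comap Nb : Submodule k (ι' → k)) with hKb
  -- UPPER BOUND: the translate of `K_a ⊓ K_b` by the two-row base point lies in `bU {r = 0}`
  have hv : bL (fun w : Fin 4 × Fin 4 =>
      (Matrix.of ![![0, 1, 1, 1], ![1, 0, 0, 0], ![0, 0, 0, 0], ![0, 0, 0, 0]]) w.1 w.2) = 0 := (hker _).2 (w2_v_support k)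
  have hvu : IsUnit (D + CL (fun w : Fin 4 × Fin 4 =>
      (Matrix.of ![![0, 1, 1, 1], ![1, 0, 0, 0], ![0, 0, 0, 0], ![0, 0, 0, 0]]) w.1 w.2)).det := (hN _ hv).1
  set T : (ι' → k) →ₗ[k] (ι' → k) := ((D + CL (fun w : Fin 4 × Fin 4 =>
      (Matrix.of ![![0, 1, 1, 1], ![1, 0, 0, 0], ![0, 0, 0, 0], ![0, 0, 0, 0]]) w.1 w.2)) * D⁻¹).mulVecLin with hTdef
  have hTinj : Function.Injective T := by
    rw [hTdef, Matrix.coe_mulVecLin, Matrix.mulVec_injective_iff_isUnit,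
      Matrix.isUnit_iff_isUnit_det, Matrix.det_mul]
    exact hvu.mul (Matrix.isUnit_nonsing_inv_det_iff.2 hD)
  have hT : ∀ y, T y = y + Na y + Nb y := by
    intro y
    rw [hTdef, hNa, hNb, Matrix.mulVecLin_apply, Matrix.mulVecLin_apply, Matrix.mulVecLin_apply,
      w2_v_eq k, map_add, Matrix.add_mul, Matrix.add_mul, Matrix.mul_nonsing_inv _ hD,
      Matrix.add_mulVec, Matrix.add_mulVec, Matrix.one_mulVec, add_assoc]
  set G := LinearMap.range (bU ∘ₗ LinearMap.inr k (Fin 2 × Fin 3 → k) (Fin 4 → k)) with hG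
  have hTS : (Ka ⊓ Kb).map T ≤ G := by
    rintro _ ⟨y, hy, rfl⟩
    obtain ⟨hya, hyb⟩ := Submodule.mem_inf.1 hy
    obtain ⟨hyB, hyNa⟩ := Submodule.mem_inf.1 hya
    obtain ⟨-, hyNb⟩ := Submodule.mem_inf.1 hyb
    rw [Submodule.mem_comap] at hyNa hyNb
    have hTy : T y ∈ B := by rw [hT]; exact B.add_mem (B.add_mem hyB hyNa) hyNb
    obtain ⟨x, hx⟩ := hTy
    obtain ⟨z'', hz''⟩ := hyB
    have hy' : bL x = ((D + CL (fun w : Fin 4 × Fin 4 =>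
      (Matrix.of ![![0, 1, 1, 1], ![1, 0, 0, 0], ![0, 0, 0, 0], ![0, 0, 0, 0]]) w.1 w.2)) * D⁻¹) *ᵥ bL z'' := by
      rw [hx, hTdef, Matrix.mulVecLin_apply, hz'']
    obtain ⟨⟨h21, h22, h23⟩, h31, h32, h33⟩ :=
      w2_pair_vanish hDs bL CL hCs hκ hi hN 1 1 one_ne_zero one_ne_zero (by simpa using hv) x z''
        (by simpa using hy')
    have hxU : bL x = bU ((0 : Fin 2 × Fin 3 → k), ![x (1, 2), x (1, 3), x (2, 0), x (3, 0)]) := by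
      rw [hbU', ← sub_eq_zero, ← map_sub]
      exact (hker _).2 (w2_residual x h21 h22 h23 h31 h32 h33)
    refine ⟨![x (1, 2), x (1, 3), x (2, 0), x (3, 0)], ?_⟩
    rw [LinearMap.comp_apply, LinearMap.inr_apply, ← hxU, hx]
  have hG4 : finrank k G ≤ 4 := by
    have := LinearMap.finrank_range_le (bU ∘ₗ LinearMap.inr k (Fin 2 × Fin 3 → k) (Fin 4 → k))
    simpa using this
  have h4 : finrank k (Ka ⊓ Kb : Submodule k (ι' → k)) ≤ 4 := by
    rw [(Submodule.equivMapOfInjective T hTinj _).finrank_eq]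
    exact (Submodule.finrank_mono hTS).trans hG4
  -- LOWER BOUND: in each sign case `K_a + K_b` lies in the image of a hyperplane
  have hU10 : finrank k ((Fin 2 × Fin 3 → k) × (Fin 4 → k)) = 10 := by
    rw [Module.finrank_prod]; simp
  have count : ∀ (lam : ((Fin 2 × Fin 3 → k) × (Fin 4 → k)) →ₗ[k] k)
      (u₀ : (Fin 2 × Fin 3 → k) × (Fin 4 → k)), lam u₀ ≠ 0 →
      (∀ y ∈ Ka, ∃ u, lam u = 0 ∧ y = bL (fun z : Fin 4 × Fin 4 => (Matrix.of ![![0, 0, 0, 0], ![0, 0, u.2 0, u.2 1],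
        ![u.2 2, u.1 (0, 0), u.1 (0, 1), u.1 (0, 2)], ![u.2 3, u.1 (1, 0), u.1 (1, 1), u.1 (1, 2)]])
        z.1 z.2)) → (∀ y ∈ Kb, ∃ u, lam u = 0 ∧ y = bL (fun z : Fin 4 × Fin 4 => (Matrix.of ![![0, 0, 0, 0], ![0, 0, u.2 0, u.2 1],
        ![u.2 2, u.1 (0, 0), u.1 (0, 1), u.1 (0, 2)], ![u.2 3, u.1 (1, 0), u.1 (1, 1), u.1 (1, 2)]])
        z.1 z.2)) →
      False := by
    intro lam u₀ hu₀ hA hB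
    have hKa' : Ka ≤ (LinearMap.ker lam).map bU := fun y hy => by
      obtain ⟨u, hu, rfl⟩ := hA y hy
      exact ⟨u, LinearMap.mem_ker.2 hu, hbU' u⟩
    have hKb' : Kb ≤ (LinearMap.ker lam).map bU := fun y hy => by
      obtain ⟨u, hu, rfl⟩ := hB y hy
      exact ⟨u, LinearMap.mem_ker.2 hu, hbU' u⟩
    have hsurj : LinearMap.range lam = ⊤ := LinearMap.range_eq_top.2 fun c =>
      ⟨(c / lam u₀) • u₀, by rw [map_smul, smul_eq_mul, div_mul_cancel₀ c hu₀]⟩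
    have hker9 : finrank k (LinearMap.ker lam) = 9 := by
      have h := LinearMap.finrank_range_add_finrank_ker lam
      rw [hsurj, finrank_top, Module.finrank_self, hU10] at h
      omega
    have hsup : finrank k (Ka ⊔ Kb : Submodule k (ι' → k)) ≤ 9 :=
      (Submodule.finrank_mono (sup_le hKa' hKb')).trans
        ((Submodule.finrank_map_le _ _).trans hker9.le)
    have := Submodule.finrank_sup_add_finrank_inf_eq Ka Kb
    omega
  -- the four hyperplanes
  let F := LinearMap.fst k (Fin 2 × Fin 3 → k) (Fin 4 → k)
  let l01 : ((Fin 2 × Fin 3 → k) × (Fin 4 → k)) →ₗ[k] k := LinearMap.proj ((0 : Fin 2), (1 : Fin 3)) ∘ₗ F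
  let l02 : ((Fin 2 × Fin 3 → k) × (Fin 4 → k)) →ₗ[k] k := LinearMap.proj ((0 : Fin 2), (2 : Fin 3)) ∘ₗ F
  let l11 : ((Fin 2 × Fin 3 → k) × (Fin 4 → k)) →ₗ[k] k := LinearMap.proj ((1 : Fin 2), (1 : Fin 3)) ∘ₗ F
  let l12 : ((Fin 2 × Fin 3 → k) × (Fin 4 → k)) →ₗ[k] k := LinearMap.proj ((1 : Fin 2), (2 : Fin 3)) ∘ₗ F
  have e01 : ∀ u, l01 u = u.1 (0, 1) := fun _ => rfl
  have e02 : ∀ u, l02 u = u.1 (0, 2) := fun _ => rfl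
  have e11 : ∀ u, l11 u = u.1 (1, 1) := fun _ => rfl
  have e12 : ∀ u, l12 u = u.1 (1, 2) := fun _ => rfl
  -- witnesses
  let w0 : (Fin 2 × Fin 3 → k) × (Fin 4 → k) := (Pi.single ((0 : Fin 2), (1 : Fin 3)) 1, 0)
  let w1 : (Fin 2 × Fin 3 → k) × (Fin 4 → k) := (Pi.single ((1 : Fin 2), (1 : Fin 3)) 1, 0)
  have hw0a : w0.1 (0, 1) = 1 := by simp [w0]
  have hw0b : w0.1 (0, 2) = 0 := by simp [w0]
  have hw1a : w1.1 (1, 1) = 1 := by simp [w1]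
  have hw1b : w1.1 (1, 2) = 0 := by simp [w1]
  rcases hXa with hX | hX <;> rcases hYb with hY | hY
  · refine count (l01 + l02) w0 (by rw [LinearMap.add_apply, e01, e02, hw0a, hw0b]; norm_num)
      (fun y hy => ?_) (fun y hy => ?_)
    · obtain ⟨u, hu, e⟩ := hX y hy
      exact ⟨u, by rw [LinearMap.add_apply, e01, e02, hu.2.2], e⟩
    · obtain ⟨u, hu, e⟩ := hY y hy
      exact ⟨u, by rw [LinearMap.add_apply, e01, e02, hu 1, hu 2, add_zero], e⟩
  · refine count l11 w1 (by rw [e11, hw1a]; exact one_ne_zero) (fun y hy => ?_) (fun y hy => ?_)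
    · obtain ⟨u, hu, e⟩ := hX y hy
      exact ⟨u, by rw [e11, hu.1], e⟩
    · obtain ⟨u, hu, e⟩ := hY y hy
      exact ⟨u, by rw [e11, hu 1], e⟩
  · refine count l01 w0 (by rw [e01, hw0a]; exact one_ne_zero) (fun y hy => ?_) (fun y hy => ?_)
    · obtain ⟨u, hu, e⟩ := hX y hy
      exact ⟨u, by rw [e01, hu.1], e⟩
    · obtain ⟨u, hu, e⟩ := hY y hy
      exact ⟨u, by rw [e01, hu 1], e⟩
  · refine count (l11 + l12) w1 (by rw [LinearMap.add_apply, e11, e12, hw1a, hw1b]; norm_num)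
      (fun y hy => ?_) (fun y hy => ?_)
    · obtain ⟨u, hu, e⟩ := hX y hy
      exact ⟨u, by rw [LinearMap.add_apply, e11, e12, hu.2.2], e⟩
    · obtain ⟨u, hu, e⟩ := hY y hy
      exact ⟨u, by rw [LinearMap.add_apply, e11, e12, hu 1, hu 2, add_zero], e⟩

end Summit.ValiantsHypothesis.ValiantsHypothesis.Theorems.SymPencilPerFourW2

end
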